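import Literature.AlgebraicGeometry.Motives.SeesawChartAway
import Literature.AlgebraicGeometry.Motives.SeesawChartFibreCyclic
import Literature.Algebra.Module.ReprModuleTwoTermKernel
import Literature.RingTheory.Localization.FibreCyclicNakayama
import Literature.RingTheory.Localization.CyclicChartRepresentability
import HarnessLib

/-!
# The seesaw closed subscheme, chart step: representing modules and a chart at every prime of `A = Γ(W, U)`

[MumfordAV1970] §5 Theorem (p. 46) and §10 (p. 89) / [GortzWedhorn2023] Prop. 23.147, Thm. 24.66, in the vocabulary of
`SeesawChartSections` … `SeesawChartAway`:
* §1 the two statements on the Grothendieck complex of the chart — `H0KernelRepr X 𝓕 U` («a two-term complex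
  `K⁰ → K¹` of finite projective `A`-modules computes `H⁰(X_B, 𝓕_B) = ker(d ⊗ B)` for EVERY `A`-algebra `B`,
  naturally», [MumfordAV1970] §5 Lemmas 1–2) and its dual `DualKernelRepr` (the only named statements of this file;
  discharged by the (1b) files `SeesawChartKernelRepr*`);
* §2 `H0Repr`/`DualRepr`: a finitely generated `A`-module `Q` with `H⁰(X_B, 𝓕_B) ≃ₗ[B] Hom_A(Q, B)` naturally, from
  `H0KernelRepr` + ★ `ReprModuleTwoTermKernel.exists_reprModule_of_perfect_two_term` ([MumfordAV1970] §5 Theorem p. 46; [Hartshorne1977] III Prop. 12.4);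
* §3 charts at a prime `𝔭` of `A`: `ChartProp f J` («`J ⊆ A_f` represents `Triv` on `A_f`-algebras»), the EMPTY charts
  (`chartProp_top_of_h0_zero` / `_dualSec_zero`, where a fibre of `Q` or `Q′` vanishes: ★ `CyclicChart.exists_away_torsion_…`)
  and **`exists_chartProp_at`**: Nakayama (★ `CyclicChart.exists_away_cyclic_of_homCyclic`, the fibre being a line by
  ★ `h0_cyclic_of_dualSec_ne_zero`/`dualSec_cyclic_of_h0_ne_zero`) makes `Q_f`, `Q′_f` cyclic, ★ `CyclicChart.evalEquiv`
  represents them by `Ann(I)`, `Ann(I′)`, and `triv_iff_chartAway` (with ★ `evalPair_baseChange`) gives the chart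
  `(f, (I + I′)·A_f)` — the only hypotheses left are `H0Repr`/`DualRepr`.
(Cell `hodgecm-mathlib`, M13 node N1, file S7 of the split plan; HOME certificate `B-plan/m13-glue/N1-Assembly.v9.B-p01g12.lean`
164baf9abb46c288 PART III §13–§15 — decls token-identical except that every v9 brick/fibre hypothesis
(`brickA/B/D/N/β/α/α0`, `fibreCyclic`, `trivOfSubsingletonS`) is discharged by ★ names.)

## References
* [MumfordAV1970] D. Mumford, *Abelian Varieties* (1970), §5 Theorem (p. 46), §10 p. 89.
* [GortzWedhorn2023] U. Görtz, T. Wedhorn, *Algebraic Geometry II* (2023), Prop. 23.147; Thm. 24.66 (p. 405; proof pp. 407–408).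
* [Hartshorne1977] R. Hartshorne, *Algebraic Geometry* (1977), III Prop. 12.4.
* [AtiyahMacdonald1969] M. F. Atiyah, I. G. Macdonald, *Introduction to Commutative Algebra* (1969), Prop. 2.8 p. 22, Ex. 3.19 (v).
-/

set_option autoImplicit false

noncomputable section

-- `TopCat.Presheaf`/`Scheme.Modules` are not reducible (as in Mathlib's `AlgebraicGeometry/Modules`).
set_option backward.isDefEq.respectTransparency false

open CategoryTheory CategoryTheory.Limits AlgebraicGeometry MonoidalCategory CartesianMonoidalCategory
  Opposite
open scoped TensorProduct

namespace Literature.AlgebraicGeometry.Motives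

namespace SeesawSubscheme

open Literature.AlgebraicGeometry.Modules

variable (X : SchemeOver ℂ) {W : SchemeOver ℂ} (𝓕 : (X ⊗ W).left.Modules) (U : W.left.affineOpens)


/-! ## §1 The two statements on the Grothendieck complex of the chart, and brick (β) packaged -/

/-- **`H0KernelRepr X 𝓕 U`** (statement) — a two-term complex of finite projective `Γ(W, U)`-modules computes
`H⁰(X_B, 𝓕_B)` after EVERY base change, naturally ([MumfordAV1970] §5 Lemmas 1–2: the Grothendieck complex of `𝓕` on the chart).
[cite: MumfordAV1970, §5 (pp. 46–47)] [cite: GortzWedhorn2023, Prop. 23.147] -/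
def H0KernelRepr : Prop :=
  ∃ (K0 K1 : Type) (_ : AddCommGroup K0) (_ : Module Γ(W.left, U) K0) (_ : AddCommGroup K1)
    (_ : Module Γ(W.left, U) K1) (_ : Module.Finite Γ(W.left, U) K0) (_ : Module.Projective Γ(W.left, U) K0)
    (_ : Module.Finite Γ(W.left, U) K1) (_ : Module.Projective Γ(W.left, U) K1) (d : K0 →ₗ[Γ(W.left, U)] K1),
    ∃ θ : ∀ (B : Type) [CommRing B] [Algebra Γ(W.left, U) B], H0 X 𝓕 U B ≃ₗ[B] LinearMap.ker (d.baseChange B),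
      ∀ (B C : Type) [CommRing B] [Algebra Γ(W.left, U) B] [CommRing C] [Algebra Γ(W.left, U) C]
        (φ : B →ₐ[Γ(W.left, U)] C) (s : H0 X 𝓕 U B),
        ((θ C (H0map X 𝓕 U φ s) : C ⊗[Γ(W.left, U)] K0)) = φ.toLinearMap.rTensor K0 ((θ B s) : B ⊗[Γ(W.left, U)] K0)

/-- **`DualKernelRepr X 𝓕 U h𝓕`** (statement) — the same for the dual sections `Hom(𝓕_B|_⊤, 𝒪|_⊤)` (the Grothendieck
complex of `Modules.dual 𝓕`, read through `Γ((dual 𝓕)_B, ⊤) ≃ Hom(𝓕_B|_⊤, 𝒪|_⊤)`). [cite: MumfordAV1970, §5 (pp. 46–47)] -/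
def DualKernelRepr (h𝓕 : HasRank 𝓕 1) : Prop :=
  ∃ (K0 K1 : Type) (_ : AddCommGroup K0) (_ : Module Γ(W.left, U) K0) (_ : AddCommGroup K1)
    (_ : Module Γ(W.left, U) K1) (_ : Module.Finite Γ(W.left, U) K0) (_ : Module.Projective Γ(W.left, U) K0)
    (_ : Module.Finite Γ(W.left, U) K1) (_ : Module.Projective Γ(W.left, U) K1) (d : K0 →ₗ[Γ(W.left, U)] K1),
    ∃ θ : ∀ (B : Type) [CommRing B] [Algebra Γ(W.left, U) B], DualSec X 𝓕 U B ≃ₗ[B] LinearMap.ker (d.baseChange B),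
      ∀ (B C : Type) [CommRing B] [Algebra Γ(W.left, U) B] [CommRing C] [Algebra Γ(W.left, U) C]
        (φ : B →ₐ[Γ(W.left, U)] C) (μ : DualSec X 𝓕 U B),
        ((θ C (DualSecMap X 𝓕 U h𝓕 φ μ) : C ⊗[Γ(W.left, U)] K0)) =
          φ.toLinearMap.rTensor K0 ((θ B μ) : B ⊗[Γ(W.left, U)] K0)

/-- Brick (β) packaged as one `∃` (★ `CyclicChart.cyclicAnn` / `evalEquiv` / `coe_evalEquiv_comp`): cyclic
representability `Hom_A(Q, B) ≃ₗ Ann_B(I·B)` after inverting `f`, naturally. [cite: MumfordAV1970, §10 (p. 89)] -/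
private theorem brickBeta_pkg (A : Type) [CommRing A] (Q : Type) [AddCommGroup Q] [Module A Q] (f : A) (q : Q)
    (hcyc : ∀ x : Q, ∃ (n : ℕ) (a : A), f ^ n • x = a • q) :
    ∃ I : Ideal A, ∃ ev : ∀ (B : Type) [CommRing B] [Algebra A B], IsUnit (algebraMap A B f) →
        ((Q →ₗ[A] B) ≃ₗ[B] (I.map (algebraMap A B)).annihilator),
      ∀ (B C : Type) [CommRing B] [Algebra A B] [CommRing C] [Algebra A C]
        (hB : IsUnit (algebraMap A B f)) (hC : IsUnit (algebraMap A C f)) (φ : B →ₐ[A] C) (ℓ : Q →ₗ[A] B),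
        ((ev C hC ((φ.toLinearMap.restrictScalars A).comp ℓ) : C) : C) = φ (ev B hB ℓ : B) :=
  ⟨Literature.RingTheory.Localization.CyclicChart.cyclicAnn f q, fun B _ _ hB => Literature.RingTheory.Localization.CyclicChart.evalEquiv f q B hB hcyc,
    fun B C _ _ _ _ hB hC φ ℓ => Literature.RingTheory.Localization.CyclicChart.coe_evalEquiv_comp f q B C hB hC hcyc φ ℓ⟩




/-! ## §2 From the kernel representation to the representing module `Q` -/

/-- **`H0Repr`**: a finitely generated `A`-module `Q` representing `B ↦ H⁰(X_B, 𝓕_B)` naturally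
(from `H0KernelRepr` + ★ brick (D) `ReprModuleTwoTermKernel`). [cite: MumfordAV1970, §5 Theorem (p. 46)] [cite: Hartshorne1977, III Prop. 12.4] -/
def H0Repr : Prop :=
  ∃ (Q : Type) (_ : AddCommGroup Q) (_ : Module Γ(W.left, U) Q) (_ : Module.Finite Γ(W.left, U) Q),
    ∃ ρ : ∀ (B : Type) [CommRing B] [Algebra Γ(W.left, U) B], H0 X 𝓕 U B ≃ₗ[B] (Q →ₗ[Γ(W.left, U)] B),
      ∀ (B C : Type) [CommRing B] [Algebra Γ(W.left, U) B] [CommRing C] [Algebra Γ(W.left, U) C]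
        (φ : B →ₐ[Γ(W.left, U)] C) (s : H0 X 𝓕 U B),
        ρ C (H0map X 𝓕 U φ s) = (φ.toLinearMap.restrictScalars Γ(W.left, U)).comp (ρ B s)

/-- **`DualRepr`**: the same for dual sections. [cite: MumfordAV1970, §5 Theorem (p. 46)] [cite: Hartshorne1977, III Prop. 12.4] -/
def DualRepr (h𝓕 : HasRank 𝓕 1) : Prop :=
  ∃ (Q : Type) (_ : AddCommGroup Q) (_ : Module Γ(W.left, U) Q) (_ : Module.Finite Γ(W.left, U) Q),
    ∃ ρ : ∀ (B : Type) [CommRing B] [Algebra Γ(W.left, U) B], DualSec X 𝓕 U B ≃ₗ[B] (Q →ₗ[Γ(W.left, U)] B),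
      ∀ (B C : Type) [CommRing B] [Algebra Γ(W.left, U) B] [CommRing C] [Algebra Γ(W.left, U) C]
        (φ : B →ₐ[Γ(W.left, U)] C) (μ : DualSec X 𝓕 U B),
        ρ C (DualSecMap X 𝓕 U h𝓕 φ μ) = (φ.toLinearMap.restrictScalars Γ(W.left, U)).comp (ρ B μ)

/-- `H0KernelRepr` + ★ brick (D) ⇒ `H0Repr`. [cite: MumfordAV1970, §5 Theorem (p. 46)] [cite: Hartshorne1977, III Prop. 12.4] -/
theorem h0Repr_of_kernelRepr (hK : H0KernelRepr X 𝓕 U) : H0Repr X 𝓕 U := by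
  obtain ⟨K0, K1, _, _, _, _, _, _, _, _, d, θ, hθ⟩ := hK
  obtain ⟨Q, _, _, _, η, hη⟩ :=
    Literature.Algebra.Module.ReprModuleTwoTermKernel.exists_reprModule_of_perfect_two_term d
  refine ⟨Q, inferInstance, inferInstance, inferInstance, fun B _ _ => (θ B).trans (η B).symm, ?_⟩
  intro B C _ _ _ _ φ s
  apply (η C).injective
  apply Subtype.ext
  change ((η C ((η C).symm (θ C (H0map X 𝓕 U φ s)))) : C ⊗[Γ(W.left, U)] K0) =
    ((η C ((φ.toLinearMap.restrictScalars Γ(W.left, U)).comp ((η B).symm (θ B s)))) : C ⊗[Γ(W.left, U)] K0)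
  rw [LinearEquiv.apply_symm_apply, hθ, hη, LinearEquiv.apply_symm_apply]

/-- `DualKernelRepr` + ★ brick (D) ⇒ `DualRepr`. [cite: MumfordAV1970, §5 Theorem (p. 46)] [cite: Hartshorne1977, III Prop. 12.4] -/
theorem dualRepr_of_kernelRepr (h𝓕 : HasRank 𝓕 1) (hK : DualKernelRepr X 𝓕 U h𝓕) :
    DualRepr X 𝓕 U h𝓕 := by
  obtain ⟨K0, K1, _, _, _, _, _, _, _, _, d, θ, hθ⟩ := hK
  obtain ⟨Q, _, _, _, η, hη⟩ :=
    Literature.Algebra.Module.ReprModuleTwoTermKernel.exists_reprModule_of_perfect_two_term d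
  refine ⟨Q, inferInstance, inferInstance, inferInstance, fun B _ _ => (θ B).trans (η B).symm, ?_⟩
  intro B C _ _ _ _ φ μ
  apply (η C).injective
  apply Subtype.ext
  change ((η C ((η C).symm (θ C (DualSecMap X 𝓕 U h𝓕 φ μ)))) : C ⊗[Γ(W.left, U)] K0) =
    ((η C ((φ.toLinearMap.restrictScalars Γ(W.left, U)).comp ((η B).symm (θ B μ)))) : C ⊗[Γ(W.left, U)] K0)
  rw [LinearEquiv.apply_symm_apply, hθ, hη, LinearEquiv.apply_symm_apply]


/-! ## §3 Charts at a prime of `A = Γ(W, U)` -/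

section Charts

variable {X 𝓕 U}

/-- The property «`J ⊆ A_f` represents `Triv` on `A_f`-algebras» (bookkeeping). [cite: MumfordAV1970, §10 (p. 89)] -/
def ChartProp (f : Γ(W.left, U)) (J : Ideal (Localization.Away f)) : Prop :=
  ∀ (B : Type) [CommRing B] [Algebra (Localization.Away f) B],
    (letI := compAlgebra U f B; Triv X 𝓕 U B) ↔ J.map (algebraMap (Localization.Away f) B) = ⊥

/-- **The chart predicate `H0ReprChart` from `H0Repr` + cyclicity + brick (β).** [cite: MumfordAV1970, §10 (p. 89)] -/
theorem h0ReprChart_of_cyclic {Q : Type} [AddCommGroup Q] [Module Γ(W.left, U) Q]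
    (ρ : ∀ (B : Type) [CommRing B] [Algebra Γ(W.left, U) B], H0 X 𝓕 U B ≃ₗ[B] (Q →ₗ[Γ(W.left, U)] B))
    (hρ : ∀ (B C : Type) [CommRing B] [Algebra Γ(W.left, U) B] [CommRing C] [Algebra Γ(W.left, U) C]
        (φ : B →ₐ[Γ(W.left, U)] C) (s : H0 X 𝓕 U B),
        ρ C (H0map X 𝓕 U φ s) = (φ.toLinearMap.restrictScalars Γ(W.left, U)).comp (ρ B s))
    (f : Γ(W.left, U)) (q : Q) (hcyc : ∀ x : Q, ∃ (n : ℕ) (a : Γ(W.left, U)), f ^ n • x = a • q) :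
    ∃ I, H0ReprChart X 𝓕 U f I := by
  obtain ⟨I, ev, hev⟩ := brickBeta_pkg Γ(W.left, U) Q f q hcyc
  refine ⟨I, fun B _ _ hB => (ρ B).trans (ev B hB), fun B C _ _ _ _ hB hC φ s => ?_⟩
  change ((ev C hC (ρ C (H0map X 𝓕 U φ s)) : C) : C) = φ (ev B hB (ρ B s) : B)
  rw [hρ, hev B C hB hC]

/-- The dual twin of `h0ReprChart_of_cyclic`. [cite: MumfordAV1970, §10 (p. 89)] -/
theorem dualReprChart_of_cyclic (h𝓕 : HasRank 𝓕 1) {Q : Type} [AddCommGroup Q]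
    [Module Γ(W.left, U) Q]
    (ρ : ∀ (B : Type) [CommRing B] [Algebra Γ(W.left, U) B], DualSec X 𝓕 U B ≃ₗ[B] (Q →ₗ[Γ(W.left, U)] B))
    (hρ : ∀ (B C : Type) [CommRing B] [Algebra Γ(W.left, U) B] [CommRing C] [Algebra Γ(W.left, U) C]
        (φ : B →ₐ[Γ(W.left, U)] C) (μ : DualSec X 𝓕 U B),
        ρ C (DualSecMap X 𝓕 U h𝓕 φ μ) = (φ.toLinearMap.restrictScalars Γ(W.left, U)).comp (ρ B μ))
    (f : Γ(W.left, U)) (q : Q) (hcyc : ∀ x : Q, ∃ (n : ℕ) (a : Γ(W.left, U)), f ^ n • x = a • q) :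
    ∃ I', DualReprChart X 𝓕 U h𝓕 f I' := by
  obtain ⟨I, ev, hev⟩ := brickBeta_pkg Γ(W.left, U) Q f q hcyc
  refine ⟨I, fun B _ _ hB => (ρ B).trans (ev B hB), fun B C _ _ _ _ hB hC φ μ => ?_⟩
  change ((ev C hC (ρ C (DualSecMap X 𝓕 U h𝓕 φ μ)) : C) : C) = φ (ev B hB (ρ B μ) : B)
  rw [hρ, hev B C hB hC]

omit 𝓕 in
/-- Cyclicity after inverting `f₁` persists after inverting `f₁ * f₂`. [cite: MumfordAV1970, §10 (p. 89)] -/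
theorem cyclic_mul {Q : Type} [AddCommGroup Q] [Module Γ(W.left, U) Q] {f₁ : Γ(W.left, U)} (f₂ : Γ(W.left, U))
    {q : Q} (hcyc : ∀ x : Q, ∃ (n : ℕ) (a : Γ(W.left, U)), f₁ ^ n • x = a • q) :
    ∀ x : Q, ∃ (n : ℕ) (a : Γ(W.left, U)), (f₁ * f₂) ^ n • x = a • q := by
  intro x
  obtain ⟨n, a, h⟩ := hcyc x
  refine ⟨n, f₂ ^ n * a, ?_⟩
  rw [mul_pow, mul_comm (f₁ ^ n), mul_smul, h, ← mul_smul]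

omit 𝓕 in
/-- Inverting `f₁ * f₂` inverts `f₁`-cyclicity written the other way round. [cite: MumfordAV1970, §10 (p. 89)] -/
theorem cyclic_mul' {Q : Type} [AddCommGroup Q] [Module Γ(W.left, U) Q] (f₁ : Γ(W.left, U)) {f₂ : Γ(W.left, U)}
    {q : Q} (hcyc : ∀ x : Q, ∃ (n : ℕ) (a : Γ(W.left, U)), f₂ ^ n • x = a • q) :
    ∀ x : Q, ∃ (n : ℕ) (a : Γ(W.left, U)), (f₁ * f₂) ^ n • x = a • q := by
  rw [mul_comm]; exact cyclic_mul f₁ hcyc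

/-- Over an `A_f`-algebra in which `H⁰` vanishes identically, `Triv` means `B = 0`:
the EMPTY chart (one-sided use of (T-H1′) + ★ `trivOfSubsingleton`). [cite: MumfordAV1970, §10 (p. 89)] -/
theorem chartProp_top_of_h0_zero [IsProper X.hom] [GeometricallyIntegral X.hom] (f : Γ(W.left, U))
    (h0 : ∀ (B : Type) [CommRing B] [Algebra Γ(W.left, U) B], IsUnit (algebraMap Γ(W.left, U) B f) →
      ∀ s : H0 X 𝓕 U B, s = 0) :
    ChartProp (X := X) (𝓕 := 𝓕) f ⊤ := by
  intro B _ _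
  letI := compAlgebra U f B
  constructor
  · intro hB
    -- `B = 0`: otherwise a maximal ideal `𝔪` and `g ∉ 𝔪` with `H⁰(B_g) ≃ B_g`, but `H⁰(B_g) = 0`
    suffices hB0 : Subsingleton B by
      refine Submodule.ext fun x => ?_
      rw [Subsingleton.elim x 0]
      simp
    by_contra hnt
    rw [not_subsingleton_iff_nontrivial] at hnt
    obtain ⟨𝔪, h𝔪⟩ := Ideal.exists_maximal B
    obtain ⟨g, hg, ⟨ε⟩⟩ := exists_h0_linearEquiv_of_triv X 𝓕 U B hB 𝔪
    have hfg : IsUnit (algebraMap Γ(W.left, U) (Localization.Away g) f) := by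
      rw [IsScalarTower.algebraMap_apply Γ(W.left, U) B (Localization.Away g)]
      exact (isUnit_algebraMap_compAlgebra U f B).map _
    have h1 : (1 : Localization.Away g) = 0 := by
      have h := congrArg ε (h0 (Localization.Away g) hfg (ε.symm 1))
      rwa [ε.apply_symm_apply, map_zero] at h
    haveI : Subsingleton (Localization.Away g) := subsingleton_of_zero_eq_one h1.symm
    -- `B_g = 0` means `g` is nilpotent, contradicting `g ∉ 𝔪`
    have hzero : (algebraMap B (Localization.Away g)) g = 0 := Subsingleton.elim _ _
    obtain ⟨⟨m, hm⟩, hmg⟩ := (IsLocalization.map_eq_zero_iff (Submonoid.powers g) _ _).mp hzero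
    obtain ⟨n, rfl⟩ := hm
    have hgn : g ^ (n + 1) ∈ 𝔪 := by
      rw [pow_succ, show g ^ n * g = 0 from hmg]
      exact 𝔪.zero_mem
    exact hg (h𝔪.isPrime.mem_of_pow_mem _ hgn)
  · intro htop
    rw [Ideal.map_top] at htop
    have h10 : (1 : B) = 0 := by
      have h : (1 : B) ∈ (⊥ : Ideal B) := htop ▸ Submodule.mem_top
      exact (Submodule.mem_bot B).mp h
    haveI : Subsingleton B := subsingleton_of_zero_eq_one h10.symm
    exact trivOfSubsingleton X 𝓕 U B

/-- The dual twin of `chartProp_top_of_h0_zero`: if the dual sections vanish identically over `A_f`-algebras,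
`Triv` means `B = 0` (one-sided use of the dual (T-H1′)). [cite: MumfordAV1970, §10 (p. 89)] -/
theorem chartProp_top_of_dualSec_zero [IsProper X.hom] [GeometricallyIntegral X.hom] (f : Γ(W.left, U))
    (h0 : ∀ (B : Type) [CommRing B] [Algebra Γ(W.left, U) B], IsUnit (algebraMap Γ(W.left, U) B f) →
      ∀ μ : DualSec X 𝓕 U B, μ = 0) :
    ChartProp (X := X) (𝓕 := 𝓕) f ⊤ := by
  intro B _ _
  letI := compAlgebra U f B
  constructor
  · intro hB
    suffices hB0 : Subsingleton B by
      refine Submodule.ext fun x => ?_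
      rw [Subsingleton.elim x 0]
      simp
    by_contra hnt
    rw [not_subsingleton_iff_nontrivial] at hnt
    obtain ⟨𝔪, h𝔪⟩ := Ideal.exists_maximal B
    obtain ⟨g, hg, ⟨ε⟩⟩ := exists_dualSec_linearEquiv_of_triv X 𝓕 U B hB 𝔪
    have hfg : IsUnit (algebraMap Γ(W.left, U) (Localization.Away g) f) := by
      rw [IsScalarTower.algebraMap_apply Γ(W.left, U) B (Localization.Away g)]
      exact (isUnit_algebraMap_compAlgebra U f B).map _
    have h1 : (1 : Localization.Away g) = 0 := by
      have h := congrArg ε (h0 (Localization.Away g) hfg (ε.symm 1))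
      rwa [ε.apply_symm_apply, map_zero] at h
    haveI : Subsingleton (Localization.Away g) := subsingleton_of_zero_eq_one h1.symm
    have hzero : (algebraMap B (Localization.Away g)) g = 0 := Subsingleton.elim _ _
    obtain ⟨⟨m, hm⟩, hmg⟩ := (IsLocalization.map_eq_zero_iff (Submonoid.powers g) _ _).mp hzero
    obtain ⟨n, rfl⟩ := hm
    have hgn : g ^ (n + 1) ∈ 𝔪 := by
      rw [pow_succ, show g ^ n * g = 0 from hmg]
      exact 𝔪.zero_mem
    exact hg (h𝔪.isPrime.mem_of_pow_mem _ hgn)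
  · intro htop
    rw [Ideal.map_top] at htop
    have h10 : (1 : B) = 0 := by
      have h : (1 : B) ∈ (⊥ : Ideal B) := htop ▸ Submodule.mem_top
      exact (Submodule.mem_bot B).mp h
    haveI : Subsingleton B := subsingleton_of_zero_eq_one h10.symm
    exact trivOfSubsingleton X 𝓕 U B

omit 𝓕 in
/-- Transport of «every vector is a multiple of any non-zero one» along a linear equivalence. [cite: MumfordAV1970, §10 (p. 89)] -/
theorem homCyclic_of_linearEquiv {K : Type} [Field K] {M N : Type} [AddCommGroup M] [Module K M]
    [AddCommGroup N] [Module K N] (e : M ≃ₗ[K] N) (h : ∀ m₁ m₂ : M, m₁ ≠ 0 → ∃ c : K, m₂ = c • m₁) :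
    ∀ n₁ n₂ : N, n₁ ≠ 0 → ∃ c : K, n₂ = c • n₁ := by
  intro n₁ n₂ hn₁
  obtain ⟨c, hc⟩ := h (e.symm n₁) (e.symm n₂) (e.symm.map_ne_zero_iff.mpr hn₁)
  refine ⟨c, ?_⟩
  rw [← e.apply_symm_apply n₂, hc, map_smul, e.apply_symm_apply]

/-- Over an `A`-algebra in which `f` is a unit, an `A`-linear map out of a module killed by powers of `f`
vanishes. [cite: MumfordAV1970, §10 (p. 89)] -/
theorem linearMap_eq_zero_of_pow_smul_eq_zero {Q : Type} [AddCommGroup Q] [Module Γ(W.left, U) Q]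
    {f : Γ(W.left, U)} (hQ : ∀ x : Q, ∃ n : ℕ, f ^ n • x = 0) (B : Type) [CommRing B] [Algebra Γ(W.left, U) B]
    (hB : IsUnit (algebraMap Γ(W.left, U) B f)) (ℓ : Q →ₗ[Γ(W.left, U)] B) : ℓ = 0 := by
  ext x
  obtain ⟨n, hn⟩ := hQ x
  have hu : IsUnit (algebraMap Γ(W.left, U) B (f ^ n)) := by rw [map_pow]; exact hB.pow n
  refine hu.mul_left_cancel ?_
  rw [LinearMap.zero_apply, mul_zero, ← Algebra.smul_def, ← map_smul, hn, map_zero]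

/-- **A CHART AT EVERY PRIME of `A = Γ(W, U)`** ([MumfordAV1970] §10 p. 89: near `t ∈ Supp Q ∩ Supp Q′` the
chart `(f, (I ⊔ I′)·A_f)` of `triv_iff_chartAway`; off it the EMPTY chart `(f, ⊤)`), from the sockets.
[cite: MumfordAV1970, §10 (p. 89)] -/
theorem exists_chartProp_at [IsProper X.hom] [GeometricallyIntegral X.hom]
    (h𝓕 : HasRank 𝓕 1) (hR : H0Repr X 𝓕 U) (hR' : DualRepr X 𝓕 U h𝓕) (𝔭 : PrimeSpectrum Γ(W.left, U)) :
    ∃ f : Γ(W.left, U), f ∉ 𝔭.asIdeal ∧ ∃ J : Ideal (Localization.Away f), ChartProp (X := X) (𝓕 := 𝓕) f J := by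
  classical
  obtain ⟨Q, _, _, _, ρ, hρ⟩ := hR
  obtain ⟨Q', _, _, _, ρ', hρ'⟩ := hR'
  by_cases h0 : ∀ ℓ : Q →ₗ[Γ(W.left, U)] 𝔭.asIdeal.ResidueField, ℓ = 0
  · -- the fibre of `Q` at `𝔭` vanishes: EMPTY chart
    obtain ⟨f, hf, hQ⟩ := Literature.RingTheory.Localization.CyclicChart.exists_away_torsion_of_forall_linearMap_eq_zero 𝔭.asIdeal h0
    refine ⟨f, hf, ⊤, chartProp_top_of_h0_zero f fun B _ _ hB s => ?_⟩
    exact (ρ B).map_eq_zero_iff.mp (linearMap_eq_zero_of_pow_smul_eq_zero hQ B hB (ρ B s))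
  by_cases h0' : ∀ ℓ' : Q' →ₗ[Γ(W.left, U)] 𝔭.asIdeal.ResidueField, ℓ' = 0
  · -- the fibre of `Q′` at `𝔭` vanishes: EMPTY chart (dual side)
    obtain ⟨f, hf, hQ'⟩ := Literature.RingTheory.Localization.CyclicChart.exists_away_torsion_of_forall_linearMap_eq_zero 𝔭.asIdeal h0'
    refine ⟨f, hf, ⊤, chartProp_top_of_dualSec_zero f fun B _ _ hB μ => ?_⟩
    exact (ρ' B).map_eq_zero_iff.mp (linearMap_eq_zero_of_pow_smul_eq_zero hQ' B hB (ρ' B μ))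
  -- both fibres are non-zero: `Q_f`, `Q′_f` cyclic for ONE `f = f₁ f₂ ∉ 𝔭`, two-sided chart
  obtain ⟨ℓ₁, hℓ₁⟩ := not_forall.mp h0
  obtain ⟨ℓ₁', hℓ₁'⟩ := not_forall.mp h0'
  set K := 𝔭.asIdeal.ResidueField
  have hμ : ∃ μ : DualSec X 𝓕 U K, μ ≠ 0 := ⟨(ρ' K).symm ℓ₁', (ρ' K).symm.map_ne_zero_iff.mpr hℓ₁'⟩
  have hσ : ∃ σ : H0 X 𝓕 U K, σ ≠ 0 := ⟨(ρ K).symm ℓ₁, (ρ K).symm.map_ne_zero_iff.mpr hℓ₁⟩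
  have hcQ := homCyclic_of_linearEquiv (ρ K) (h0_cyclic_of_dualSec_ne_zero X 𝓕 U h𝓕 K hμ)
  have hcQ' := homCyclic_of_linearEquiv (ρ' K) (dualSec_cyclic_of_h0_ne_zero X 𝓕 U h𝓕 K hσ)
  obtain ⟨f₁, hf₁, q, hcyc⟩ := Literature.RingTheory.Localization.CyclicChart.exists_away_cyclic_of_homCyclic 𝔭.asIdeal hcQ
  obtain ⟨f₂, hf₂, q', hcyc'⟩ := Literature.RingTheory.Localization.CyclicChart.exists_away_cyclic_of_homCyclic 𝔭.asIdeal hcQ'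
  have hf : f₁ * f₂ ∉ 𝔭.asIdeal := fun h => (𝔭.isPrime.mem_or_mem h).elim hf₁ hf₂
  obtain ⟨I, hI⟩ := h0ReprChart_of_cyclic ρ hρ (f₁ * f₂) q (cyclic_mul f₂ hcyc)
  obtain ⟨I', hI'⟩ := dualReprChart_of_cyclic h𝓕 ρ' hρ' (f₁ * f₂) q' (cyclic_mul' f₁ hcyc')
  exact ⟨f₁ * f₂, hf, _, fun B _ _ => triv_iff_chartAway X 𝓕 U (f₁ * f₂) h𝓕 (evalPair_baseChange X 𝓕 U h𝓕) hI hI' B⟩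


end Charts

end SeesawSubscheme

end Literature.AlgebraicGeometry.Motives

end
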